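import Summits.QuantumFields.BalabanUV.Beta.FP.PerfectPropagatorBound

/-!
# `BalabanUV.Beta.FP.CoarseCovarianceElliptic` — road «FP» (binder row D1), row H′2-IR ∕ IR-2 leaf (iii) «n-UNIFORM REAL-ZONE ELLIPTICITY», file 1∕2:
# the PROPAGATOR-FORM LETTERS — the BF-Feynman propagator symbol `PinfSym s ph` (p231001) has a NONNEGATIVE form at every zone momentum and,
# off the origin, `Re v†·PinfSym s (d1Sym s)·v ≥ Σ‖v‖² ∕ ((π²∕4)^{2(d+1)+4}·Σ_a‖e^{is_a} − 1‖²)` (the inverse of `perfectFeynman_upper`)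

NOT IN PRINT; OUR BOOKKEEPING ([folklore] finite-dimensional linear algebra + the tree's perfect-Maxwell ellipticity BY NAME), for the road-FP OWNER's ROW REFINEMENT
«IR-2 (i)–(iii)» (journal l.21049; booking of (iii) to this seat l.≈21670; `H2IR-DESIGN.md` §IR-2 (iii)).  File 2∕2 `FP/CoarseCovarianceEllipticBound` assembles these letters
with the contour-weight Jordan bound into the n-uniform real-zone ellipticity of `Ĉ_n^{BF,mean}`.  Route of §1: for `F` Hermitian with `F·P = 1`, `w := Pv` has `Fw = v` and
`v†Pv = w†Fw`; completion of squares `0 ≤ Re (w − Λ⁻¹v)†F(w − Λ⁻¹v) = w†Fw − 2‖v‖²∕Λ + v†Fv∕Λ² ≤ w†Fw − ‖v‖²∕Λ`.  §2 instantiates at `F = feynMat (Re W_∞) ph`, `P = PinfSym`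
(`PerfectPropagatorSymbol.feynMat_mul_PinfSym`, `PerfectMaxwellElliptic.perfectFeynman_lower∕_upper`); at `ph = 0` the completed matrix is `0` and so is Mathlib's inverse.

## What is proved (`0 sorry`, every `d`)
* §1 [folklore] `star_dotProduct_self`, `star_dotProduct_mulVec_hermitian`, `re_quad_sub_smul` (completion of squares), **`re_quad_inv_ge`** (`F` Hermitian, `F * P = 1`,
  `0 ≤ Re w†Fw ≤ Λ·Σ‖w‖²` for all `w`, `0 < Λ` ⟹ `Σ‖v‖²∕Λ ≤ Re (quad P v)`), `re_quad_nonneg_of_mul_eq_one`.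
* §2 [our object] `feynMat_zero_right`, `re_star_dotProduct_feynMat`, **`re_quad_PinfSym_nonneg`** (every `s ∈ BZ`, every `ph`), **`re_quad_PinfSym_ge`** (`s ∈ BZ`, `s ≠ 0`,
  `ph ≠ 0`: `Σ‖v‖² ∕ ((π²∕4)^{2(d+1)+4}·Σ‖ph‖²) ≤ Re (quad (PinfSym s ph) v)`), `sum_norm_d1Sym_sq_le`, `sum_sq_le_card_mul_norm_sq`.
HONEST FRAMING: lower bounds on the cell's own U = 1 propagator symbol; 0 estimates of Bałaban's objects; 0∕4 row-D1 binders; NOT D1, NOT BetaPertH, NOT the continuum limit, NOT Clay.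
HONEST DEPENDENCY (verbatim): «continuum YM on T⁴ ⇐ BetaPertH ∧ nine spine estimates (0/9 proved); BetaPertH ⇐ (D1) ∧ (D4) ∧ CAP+tail; G-an2-4 gates asym, D1 and NE2/3/4.»
ABSOLUTE RULE respected: no cited fact, no `def … : Prop`, nothing of the manuscripts asserted.
Provenance: D1 formalisation swarm leaf prover 02, gen 7 (prover-b2b-balaban-beta-d1-formalise-leaf-02-g7-0), road-FP row IR-2 (iii) (OFFER l.21538, owner booking l.≈21670), 2026-08-20.
-/

noncomputable section

open Complex Set MeasureTheory Finset Matrix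
open scoped Real BigOperators ComplexConjugate
open Literature.MathematicalPhysics.QuantumFieldTheory.Balaban1983to89
open Literature.MathematicalPhysics.QuantumFieldTheory.Balaban1983to89.Beta
open B4Strip (ofRealVec S1r)
open B4ContourShift (BZ)
open B5Prop11Fiber (d1Sym norm_d1Sym_sq)
open Summit.QuantumFields.BalabanUV.Beta.FP.PerfectSymbol166 (W166Inf)
open Summit.QuantumFields.BalabanUV.Beta.FP.PerfectMaxwellSymbol (maxwellQ maxwellQ_nonneg)
open Summit.QuantumFields.BalabanUV.Beta.FP.PerfectMaxwellElliptic (perfectFeynman_lower perfectFeynman_upper)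
open Summit.QuantumFields.BalabanUV.Beta.FP.PerfectPropagatorSymbol (curlRow maxwellMat feynMat quad PinfSym quad_eq_dotProduct quad_feynMat
  feynMat_isHermitian feynMat_mul_PinfSym isUnit_det_feynMat)

namespace Summit.QuantumFields.BalabanUV.Beta.FP.CoarseCovarianceElliptic

variable {d : ℕ}

/-! ## §1 A quantitative lower bound on the form of an inverse -/

section Inverse

variable {m : ℕ}

/-- [folklore] `star v ⬝ᵥ v = Σ ‖v‖²` (as a real number cast to `ℂ`). -/
theorem star_dotProduct_self (v : Fin m → ℂ) : star v ⬝ᵥ v = ((∑ α, ‖v α‖ ^ 2 : ℝ) : ℂ) := by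
  simp only [dotProduct, Pi.star_apply, RCLike.star_def, Complex.conj_mul', Complex.ofReal_sum, Complex.ofReal_pow]

/-- [folklore] For a Hermitian `F`: `star w ⬝ᵥ (F *ᵥ v) = star (star v ⬝ᵥ (F *ᵥ w))`. -/
theorem star_dotProduct_mulVec_hermitian {F : Matrix (Fin m) (Fin m) ℂ} (hF : F.IsHermitian) (v w : Fin m → ℂ) :
    star w ⬝ᵥ (F *ᵥ v) = star (star v ⬝ᵥ (F *ᵥ w)) := by
  rw [star_dotProduct, star_mulVec, ← dotProduct_mulVec, hF.eq]

/-- [folklore] COMPLETION OF SQUARES: if `F` is Hermitian, `F *ᵥ w = v`, then for real `t`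
`Re (star (w − t•v) ⬝ᵥ (F *ᵥ (w − t•v))) = Re (star w ⬝ᵥ (F *ᵥ w)) − 2t·Σ‖v‖² + t²·Re (star v ⬝ᵥ (F *ᵥ v))`. -/
theorem re_quad_sub_smul {F : Matrix (Fin m) (Fin m) ℂ} (hF : F.IsHermitian) {w v : Fin m → ℂ} (hFw : F *ᵥ w = v) (t : ℝ) :
    (star (w - (t : ℂ) • v) ⬝ᵥ (F *ᵥ (w - (t : ℂ) • v))).re
      = (star w ⬝ᵥ (F *ᵥ w)).re - 2 * t * ∑ α, ‖v α‖ ^ 2 + t ^ 2 * (star v ⬝ᵥ (F *ᵥ v)).re := by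
  have h1 : star w ⬝ᵥ (F *ᵥ v) = star (star v ⬝ᵥ v) := by
    rw [star_dotProduct_mulVec_hermitian hF, hFw]
  rw [mulVec_sub, mulVec_smul, hFw, star_sub, star_smul, sub_dotProduct, dotProduct_sub, dotProduct_sub, smul_dotProduct,
    smul_dotProduct, dotProduct_smul, dotProduct_smul, h1, star_dotProduct_self]
  simp only [Complex.star_def, Complex.conj_ofReal, smul_eq_mul, Complex.sub_re, Complex.re_ofReal_mul, Complex.ofReal_re]
  ring

/-- [folklore] **LOWER BOUND ON THE FORM OF THE INVERSE**: `F` Hermitian, `F * P = 1`, `0 ≤ Re w†Fw` and `Re w†Fw ≤ Λ·Σ‖w‖²` for all `w`, `0 < Λ` ⟹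
`Σ‖v‖²∕Λ ≤ Re (quad P v)` (take `w = Pv`, so `Fw = v` and `quad P v = w†Fw`; then `0 ≤ Re (w − Λ⁻¹v)†F(w − Λ⁻¹v) = w†Fw − 2‖v‖²∕Λ + v†Fv∕Λ²`). -/
theorem re_quad_inv_ge {F P : Matrix (Fin m) (Fin m) ℂ} (hF : F.IsHermitian) (hFP : F * P = 1) {Λ : ℝ} (hΛ : 0 < Λ)
    (hpos : ∀ w : Fin m → ℂ, 0 ≤ (star w ⬝ᵥ (F *ᵥ w)).re) (hup : ∀ w : Fin m → ℂ, (star w ⬝ᵥ (F *ᵥ w)).re ≤ Λ * ∑ α, ‖w α‖ ^ 2)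
    (v : Fin m → ℂ) : (∑ α, ‖v α‖ ^ 2) / Λ ≤ (quad P v).re := by
  set w : Fin m → ℂ := P *ᵥ v with hw
  have hFw : F *ᵥ w = v := by rw [hw, mulVec_mulVec, hFP, one_mulVec]
  have hq : (quad P v).re = (star w ⬝ᵥ (F *ᵥ w)).re := by
    rw [quad_eq_dotProduct, hFw, hw, star_dotProduct]
    simp only [Complex.star_def, Complex.conj_re]
  have h0 := hpos (w - ((Λ⁻¹ : ℝ) : ℂ) • v)
  rw [re_quad_sub_smul hF hFw] at h0
  have hv := hup v
  rw [hq]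
  have hΛ' : Λ⁻¹ ^ 2 * (star v ⬝ᵥ (F *ᵥ v)).re ≤ Λ⁻¹ * ∑ α, ‖v α‖ ^ 2 := by
    have := mul_le_mul_of_nonneg_left hv (sq_nonneg Λ⁻¹)
    calc Λ⁻¹ ^ 2 * (star v ⬝ᵥ (F *ᵥ v)).re ≤ Λ⁻¹ ^ 2 * (Λ * ∑ α, ‖v α‖ ^ 2) := this
      _ = Λ⁻¹ * ∑ α, ‖v α‖ ^ 2 := by field_simp
  rw [div_eq_inv_mul]
  linarith

/-- [folklore] With the same data the form of the inverse is nonnegative: `0 ≤ Re (quad P v)`. -/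
theorem re_quad_nonneg_of_mul_eq_one {F P : Matrix (Fin m) (Fin m) ℂ} (hFP : F * P = 1)
    (hpos : ∀ w : Fin m → ℂ, 0 ≤ (star w ⬝ᵥ (F *ᵥ w)).re) (v : Fin m → ℂ) : 0 ≤ (quad P v).re := by
  have hFw : F *ᵥ (P *ᵥ v) = v := by rw [mulVec_mulVec, hFP, one_mulVec]
  have h := hpos (P *ᵥ v)
  rw [hFw] at h
  rw [quad_eq_dotProduct, star_dotProduct, Complex.star_def, Complex.conj_re]
  exact h

end Inverse

/-! ## §2 The BF propagator symbol: positivity everywhere, quantitative lower bound off the origin -/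

/-- [folklore] The completed Maxwell matrix vanishes at zero momentum factors: `feynMat W 0 = 0`. -/
theorem feynMat_zero_right (W : Fin (d + 1) → Fin (d + 1) → ℝ) : feynMat W (0 : Fin (d + 1) → ℂ) = 0 := by
  ext α β
  simp [feynMat, maxwellMat, curlRow]

/-- [folklore] `Re (star w ⬝ᵥ (feynMat W ph *ᵥ w)) = maxwellQ W ph w + ‖Σ ph·conj w‖²` (`quad_feynMat` in `dotProduct` currency). -/
theorem re_star_dotProduct_feynMat (W : Fin (d + 1) → Fin (d + 1) → ℝ) (ph w : Fin (d + 1) → ℂ) :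
    (star w ⬝ᵥ (feynMat W ph *ᵥ w)).re = maxwellQ W ph w + ‖∑ μ, ph μ * conj (w μ)‖ ^ 2 := by
  rw [← quad_eq_dotProduct, quad_feynMat, Complex.ofReal_re]

/-- [our object] **THE BF PROPAGATOR FORM IS NONNEGATIVE at every real momentum of the zone and every momentum-factor vector** (`= 0`-junk at `ph = 0`,
where `feynMat = 0` and Mathlib's inverse is `0`). -/
theorem re_quad_PinfSym_nonneg {s : Fin (d + 1) → ℝ} (hs : s ∈ BZ (d + 1)) (ph v : Fin (d + 1) → ℂ) : 0 ≤ (quad (PinfSym s ph) v).re := by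
  by_cases hph : ph = 0
  · subst hph
    simp [PinfSym, feynMat_zero_right, quad, Matrix.inv_zero]
  · refine re_quad_nonneg_of_mul_eq_one (feynMat_mul_PinfSym hs hph) (fun w => ?_) v
    rw [re_star_dotProduct_feynMat]
    have h := perfectFeynman_lower hs ph w
    have h0 : 0 ≤ (4 / Real.pi ^ 2) ^ (d + 1 + 2) * ((∑ μ, ‖ph μ‖ ^ 2) * ∑ ν, ‖w ν‖ ^ 2) := by positivity
    linarith

/-- [our object] **QUANTITATIVE LOWER BOUND ON THE BF PROPAGATOR FORM off the origin**: for `s ∈ BZ`, `s ≠ 0`, `ph ≠ 0`,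
`Σ‖v‖² ∕ ((π²∕4)^{2(d+1)+4}·Σ‖ph‖²) ≤ Re (quad (PinfSym s ph) v)`. -/
theorem re_quad_PinfSym_ge {s : Fin (d + 1) → ℝ} (hs : s ∈ BZ (d + 1)) (h0 : s ≠ 0) {ph : Fin (d + 1) → ℂ} (hph : ph ≠ 0)
    (v : Fin (d + 1) → ℂ) :
    (∑ α, ‖v α‖ ^ 2) / ((Real.pi ^ 2 / 4) ^ (2 * (d + 1) + 4) * ∑ μ, ‖ph μ‖ ^ 2) ≤ (quad (PinfSym s ph) v).re := by
  obtain ⟨ν₀, hν₀⟩ : ∃ ν₀, s ν₀ ≠ 0 := by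
    by_contra hall; push Not at hall; exact h0 (funext hall)
  have hph2 : 0 < ∑ μ, ‖ph μ‖ ^ 2 := PerfectPropagatorBound.sum_norm_sq_pos hph
  have hΛ : 0 < (Real.pi ^ 2 / 4) ^ (2 * (d + 1) + 4) * ∑ μ, ‖ph μ‖ ^ 2 := by positivity
  refine re_quad_inv_ge (feynMat_isHermitian _ ph) (feynMat_mul_PinfSym hs hph) hΛ (fun w => ?_) (fun w => ?_) v
  · rw [re_star_dotProduct_feynMat]
    have h := perfectFeynman_lower hs ph w
    have h0' : 0 ≤ (4 / Real.pi ^ 2) ^ (d + 1 + 2) * ((∑ μ, ‖ph μ‖ ^ 2) * ∑ ν, ‖w ν‖ ^ 2) := by positivity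
    linarith
  · rw [re_star_dotProduct_feynMat]
    have h := perfectFeynman_upper hs ν₀ hν₀ ph w
    linarith

/-- [folklore] `Σ_a ‖d1Sym s a‖² ≤ Σ_a (s a)²` (`‖e^{ix} − 1‖² = 2 − 2cos x ≤ x²`; the scalar inequality is `Beta.SymbolExpansion.S1r_le_sq`, re-derived inline
from Mathlib's `Real.one_sub_sq_div_two_le_cos` to keep the imports light). -/
theorem sum_norm_d1Sym_sq_le (s : Fin (d + 1) → ℝ) : ∑ a, ‖d1Sym s a‖ ^ 2 ≤ ∑ a, s a ^ 2 :=
  Finset.sum_le_sum fun a _ => by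
    rw [norm_d1Sym_sq]
    unfold S1r
    have := Real.one_sub_sq_div_two_le_cos (x := s a)
    linarith

/-- [folklore] `Σ_a (s a)² ≤ (d+1)·‖s‖∞²` (sup norm on `ℝ^{d+1}`). -/
theorem sum_sq_le_card_mul_norm_sq (s : Fin (d + 1) → ℝ) : ∑ a, s a ^ 2 ≤ ((d : ℝ) + 1) * ‖s‖ ^ 2 := by
  calc ∑ a, s a ^ 2 ≤ ∑ _a : Fin (d + 1), ‖s‖ ^ 2 := Finset.sum_le_sum fun a _ => by
          rw [← sq_abs]; exact pow_le_pow_left₀ (abs_nonneg _) (by simpa using norm_le_pi_norm s a) 2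
    _ = ((d : ℝ) + 1) * ‖s‖ ^ 2 := by simp

end Summit.QuantumFields.BalabanUV.Beta.FP.CoarseCovarianceElliptic

end
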